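import Summits.NavierStokesRegularity.FluidComputer.RowCircuitForced
import Summits.NavierStokesRegularity.FluidComputer.RowCircuitForcedFlow
import HarnessLib

/-!
# The robust one-scale transfer, hypothesis-free in the solution (layer R, class U;
# `pub-fluidc-bp3/R1-DESIGN.md` §11.11)

HONEST FRAMING (cell `pub-fluidc`, blueprint seat bp3, gen 22): low prior, high value-of-information
experiment on Tao's machine paradigm; NOT a claim that NS blows up.

WHAT. `RowChain.robust_transfer`: for EVERY continuous forcing `δF` in the uniform class `U`
(`|δF(σ)ₐ| ≤ δU a`, `2⁻¹⁹` on the first gate's block, `2⁻²⁹` on the second's) the forced circuit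
`ẏ = F gK ΛK (y) + δF(σ)` HAS a global solution from the designed state `X0`
(`CircuitFlow.forced_solution`, Grönwall + the cited global-existence theorem), and EVERY such
solution reaches, at a physical time `τ` with `|τ − 19/20| ≤ 1/200`, a state with `a₂(τ) ≥
2409/2500` and `|yₐ(τ)| ≤ capQ a` (`RowChain.forced_transfer`: all 1066 certified enclosures of the
k53d chain, re-timed). The only inputs are `δF`, its continuity and its size.
[cite: Tao2016AveragedNS, §5.5 Thm 5.3 (5.5)]
-/

noncomputable section

namespace Summit.NavierStokesRegularity.FluidComputer

open Literature.Analysis.FluidPDE.FluidComputer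

namespace RowChain

open RowCheck RowCheck.RowData RowRun ChainField

/-- `δU ≤ 2⁻¹⁹` in every coordinate. [folklore] -/
theorem δUQ_le (a : Fin 9) : (δUQ a : ℝ) ≤ 1 / 524288 := by
  fin_cases a <;> norm_num [δUQ]

/-- **The robust one-scale transfer (class `U`), existence included.** [folklore] -/
theorem robust_transfer {δF : ℝ → Fin 9 → ℝ} (hδc : Continuous δF)
    (hδ : ∀ σ a, |δF σ a| ≤ (δUQ a : ℝ)) :
    (∃ y : ℝ → Fin 9 → ℝ, y 0 = X0 ∧ ∀ σ, HasDerivAt y (F gK ΛK (y σ) + δF σ) σ) ∧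
    ∀ y : ℝ → Fin 9 → ℝ, y 0 = X0 → (∀ σ, HasDerivAt y (F gK ΛK (y σ) + δF σ) σ) →
      ∃ τ : ℝ, |τ - 19 / 20| ≤ 1 / 200 ∧ (2409 : ℝ) / 2500 ≤ y τ 4 ∧
        ∀ a, |y τ a| ≤ (capQ a : ℝ) :=
  ⟨CircuitFlow.forced_solution gK ΛK hδc (fun t a => (hδ t a).trans (δUQ_le a)) X0,
    fun _ hy0 hy => forced_transfer hy0 hy hδc hδ⟩

end RowChain

end Summit.NavierStokesRegularity.FluidComputer
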